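import Summits.Ventures.DiscreteObjects.Hadamard.ConferenceGraph333FixedSubgraph

/-!
# Element-order census of Aut(srg(333,166,82,83)), part D (gen-30 windows): no element of order 55, 77, 105 (kernel)

Framing: lottery ticket; floor = certified bounds/negative ranges.  Cell pub-namedobj (venture DiscreteObjects),
target (H) = `H(668)`, hadamard gen 30.  Continuation of `ConferenceGraph333OrderCensusA/B/C` (gen 29) with the sharper
prime windows of gen 30 (`ConferenceGraph333FixedSubgraph.aut_prime_windows_fs`: order `11 ⇒ f = 25`, order
`7 ⇒ f ∈ {25, 39}`, order `5 ⇒ 13 ≤ f`, order `3 ⇒ 9 ≤ f`): the census kit `aut_cycle_length_census` (gen 29) plus these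
windows kill three further element orders, each by one `omega` call under default heartbeats (GENERATED by
`code/gen/gen_orders_g30.py`, fact selection `code/kernel_facts_g30.py`, script census `code/order_census_g30.py`):
* **`no_aut_order_55`** (`σ^55 = 1`, `σ^11 ≠ 1`, `σ^5 ≠ 1`): `Fix(σ^5) = 25` (order `11`), `Fix(σ^11) ≥ 13` with the
  congruences of the cycle-type parity law — no solution.
* **`no_aut_order_77`**: `Fix(σ^7) = 25`, `Fix(σ^11) ∈ {25, 39}` force four `77`-cycles and `25` fixed points, against the
  orbit bound `77·26 > 333`.
* **`no_aut_order_105`**.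
Together with gen 30's `no_aut_pow_eq_one_13/23/25/81` the script-level admissible element orders (all kernel laws, exact:
code/order_census_g30.py) are the 54 values `2–12, 14, 15, 16, 18, 20, 21, 22, 24, 27, 28, 30, 32, 33, 35, 36, 37, 40,
41, 42, 44, 45, 48, 54, 56, 60, 63, 64, 66, 70, 72, 74, 80, 82, 83, 84, 88, 90, 96, 108, 120, 132, 148, 166`
(gen 29: 71 values).  WORDS: structure of a HYPOTHETICAL object; ours (PROVISIONAL).  No `sorry`, no new definitions.
-/

namespace Summit.Ventures.DiscreteObjects.Hadamard

open Finset

section ordersD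
variable {V : Type*} [Fintype V] [DecidableEq V]

/-- **No automorphism of order `55`** (census kit + windows; gen-30 windows; cf. code/order_census_g30.py). -/
theorem no_aut_order_55 (hV : Fintype.card V = 333) (A : Matrix V V ℤ)
    (h01 : ∀ x y, A x y = 0 ∨ A x y = 1) (hsymm : ∀ x y, A y x = A x y) (hdiag : ∀ x, A x x = 0)
    (hk : ∀ x, ∑ y, A x y = 166) (hsrg : ∀ x y, ∑ z, A x z * A z y = 83 * (1 + (if x = y then 1 else 0)) - A x y)
    (σ : Equiv.Perm V) (hσ : σ ^ 55 = 1) (hσ11 : σ ^ 11 ≠ 1) (hσ5 : σ ^ 5 ≠ 1) (hA : ∀ x y, A (σ x) (σ y) = A x y) : False := by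
  have hAk := adj_pow_invariant A σ hA
  obtain ⟨c, h1, h2, -, h4, h6⟩ := aut_cycle_length_census hV A h01 hsymm hdiag hk hsrg σ hσ (by norm_num) hA
  have hD : Nat.divisors 55 = {1, 5, 11, 55} := by decide
  have f1 := h2 1
  have f5 := h2 5
  have f11 := h2 11
  have e5 := h6 5 (by norm_num)
  have e11 := h6 11 (by norm_num)
  have e55 := h6 55 (by norm_num)
  rw [pow_one] at f1
  simp only [hD, Finset.sum_filter] at h1 f1 f5 f11
  norm_num at h1 f1 f5 f11
  have hp11 : (σ ^ 11) ^ 5 = 1 := by rw [← pow_mul]; exact hσ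
  obtain ⟨-, w11, -, -, -, -, -, -, -, -⟩ :=
    aut_prime_windows_fs hV A h01 hsymm hdiag hk hsrg (by norm_num : Nat.Prime 5) (by norm_num) (σ ^ 11) hp11 hσ11 (hAk 11)
  have hw11 := (w11 rfl).2
  rw [f11] at hw11
  have hp5 : (σ ^ 5) ^ 11 = 1 := by rw [← pow_mul]; exact hσ
  obtain ⟨-, -, -, w5, -, -, -, -, -, -⟩ :=
    aut_prime_windows_fs hV A h01 hsymm hdiag hk hsrg (by norm_num : Nat.Prime 11) (by norm_num) (σ ^ 5) hp5 hσ5 (hAk 5)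
  have hw5 := w5 rfl
  rw [f5] at hw5
  clear hAk h2 h4 h6 hD hA hsrg hk hdiag hsymm h01 hσ hp11 hp5
  omega

/-- **No automorphism of order `77`** (census kit + windows; gen-30 windows; cf. code/order_census_g30.py). -/
theorem no_aut_order_77 (hV : Fintype.card V = 333) (A : Matrix V V ℤ)
    (h01 : ∀ x y, A x y = 0 ∨ A x y = 1) (hsymm : ∀ x y, A y x = A x y) (hdiag : ∀ x, A x x = 0)
    (hk : ∀ x, ∑ y, A x y = 166) (hsrg : ∀ x y, ∑ z, A x z * A z y = 83 * (1 + (if x = y then 1 else 0)) - A x y)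
    (σ : Equiv.Perm V) (hσ : σ ^ 77 = 1) (hσ11 : σ ^ 11 ≠ 1) (hσ7 : σ ^ 7 ≠ 1) (hA : ∀ x y, A (σ x) (σ y) = A x y) : False := by
  have hAk := adj_pow_invariant A σ hA
  obtain ⟨c, h1, h2, -, h4, h6⟩ := aut_cycle_length_census hV A h01 hsymm hdiag hk hsrg σ hσ (by norm_num) hA
  have hD : Nat.divisors 77 = {1, 7, 11, 77} := by decide
  have f1 := h2 1
  have f7 := h2 7
  have f11 := h2 11
  have e7 := h6 7 (by norm_num)
  have e11 := h6 11 (by norm_num)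
  have e77 := h6 77 (by norm_num)
  have o77 := h4 77 (by norm_num)
  rw [pow_one] at f1
  simp only [hD, Finset.sum_filter] at h1 f1 f7 f11
  norm_num at h1 f1 f7 f11
  rw [f1] at o77
  have hp11 : (σ ^ 11) ^ 7 = 1 := by rw [← pow_mul]; exact hσ
  obtain ⟨-, -, w11, -, -, -, -, -, -, -⟩ :=
    aut_prime_windows_fs hV A h01 hsymm hdiag hk hsrg (by norm_num : Nat.Prime 7) (by norm_num) (σ ^ 11) hp11 hσ11 (hAk 11)
  have hw11 := w11 rfl
  rw [f11] at hw11
  have hp7 : (σ ^ 7) ^ 11 = 1 := by rw [← pow_mul]; exact hσ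
  obtain ⟨-, -, -, w7, -, -, -, -, -, -⟩ :=
    aut_prime_windows_fs hV A h01 hsymm hdiag hk hsrg (by norm_num : Nat.Prime 11) (by norm_num) (σ ^ 7) hp7 hσ7 (hAk 7)
  have hw7 := w7 rfl
  rw [f7] at hw7
  clear hAk h2 h4 h6 hD hA hsrg hk hdiag hsymm h01 hσ hp11 hp7
  rcases o77 with o77a | o77b <;> omega

/-- **No automorphism of order `105`** (census kit + windows; gen-30 windows; cf. code/order_census_g30.py). -/
theorem no_aut_order_105 (hV : Fintype.card V = 333) (A : Matrix V V ℤ)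
    (h01 : ∀ x y, A x y = 0 ∨ A x y = 1) (hsymm : ∀ x y, A y x = A x y) (hdiag : ∀ x, A x x = 0)
    (hk : ∀ x, ∑ y, A x y = 166) (hsrg : ∀ x y, ∑ z, A x z * A z y = 83 * (1 + (if x = y then 1 else 0)) - A x y)
    (σ : Equiv.Perm V) (hσ : σ ^ 105 = 1) (hσ35 : σ ^ 35 ≠ 1) (hσ21 : σ ^ 21 ≠ 1) (hσ15 : σ ^ 15 ≠ 1) (hA : ∀ x y, A (σ x) (σ y) = A x y) : False := by
  have hAk := adj_pow_invariant A σ hA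
  obtain ⟨c, h1, h2, -, h4, h6⟩ := aut_cycle_length_census hV A h01 hsymm hdiag hk hsrg σ hσ (by norm_num) hA
  have hD : Nat.divisors 105 = {1, 3, 5, 7, 15, 21, 35, 105} := by decide
  have f1 := h2 1
  have f3 := h2 3
  have f5 := h2 5
  have f7 := h2 7
  have f15 := h2 15
  have f21 := h2 21
  have f35 := h2 35
  have e3 := h6 3 (by norm_num)
  have e5 := h6 5 (by norm_num)
  have e7 := h6 7 (by norm_num)
  have e15 := h6 15 (by norm_num)
  have e21 := h6 21 (by norm_num)
  have e35 := h6 35 (by norm_num)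
  have e105 := h6 105 (by norm_num)
  rw [pow_one] at f1
  simp only [hD, Finset.sum_filter] at h1 f1 f3 f5 f7 f15 f21 f35
  norm_num at h1 f1 f3 f5 f7 f15 f21 f35
  have hp35 : (σ ^ 35) ^ 3 = 1 := by rw [← pow_mul]; exact hσ
  obtain ⟨w35, -, -, -, -, -, -, -, -, -⟩ :=
    aut_prime_windows_fs hV A h01 hsymm hdiag hk hsrg (by norm_num : Nat.Prime 3) (by norm_num) (σ ^ 35) hp35 hσ35 (hAk 35)
  have hw35 := (w35 rfl).2
  rw [f35] at hw35
  have hp21 : (σ ^ 21) ^ 5 = 1 := by rw [← pow_mul]; exact hσ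
  obtain ⟨-, w21, -, -, -, -, -, -, -, -⟩ :=
    aut_prime_windows_fs hV A h01 hsymm hdiag hk hsrg (by norm_num : Nat.Prime 5) (by norm_num) (σ ^ 21) hp21 hσ21 (hAk 21)
  have hw21 := (w21 rfl).2
  rw [f21] at hw21
  have hp15 : (σ ^ 15) ^ 7 = 1 := by rw [← pow_mul]; exact hσ
  obtain ⟨-, -, w15, -, -, -, -, -, -, -⟩ :=
    aut_prime_windows_fs hV A h01 hsymm hdiag hk hsrg (by norm_num : Nat.Prime 7) (by norm_num) (σ ^ 15) hp15 hσ15 (hAk 15)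
  have hw15 := w15 rfl
  rw [f15] at hw15
  clear hAk h2 h4 h6 hD hA hsrg hk hdiag hsymm h01 hσ hp35 hp21 hp15
  omega

end ordersD

end Summit.Ventures.DiscreteObjects.Hadamard
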